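import Mathlib
import Summits.KontsevichZagierPeriods.Zeta5Search.Families.CubicalChartFiveSpans
import Summits.KontsevichZagierPeriods.Zeta5Search.Families.CubicalChartLeadPi8v
import Summits.KontsevichZagierPeriods.Zeta5Search.Families.SeatingGapGrowth
import Summits.KontsevichZagierPeriods.Zeta5Search.Families.CellularEightGrowthConstantsC
import Summits.KontsevichZagierPeriods.Zeta5Search.Families.BasicGrowthClasses
import Summits.KontsevichZagierPeriods.Zeta5Search.Brown8.LeadingCoefficientsA
import HarnessLib

/-!
# ζ(5) search — fam-brown8's census leading coefficients `lead_pi9` (class ₈π₉) and `lead_pi9v` (class ₈π₉^∨) ARE gap constant terms; growth exponents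

HONEST FRAMING: systematic search; no irrationality claim unless certified.  Cell `pub-zeta5`, certifier 2 (cert-2 g11,
2026-08-22).  Identities between integers (binomial sums / polynomial coefficients) and the elementary real analysis of
`Families/SeatingGapGrowth`; nothing about `ζ(5)`; no number of record moves; no conjecture node is used or discharged
(the census recurrences `Brown8.LeadRec_<class>` stay GUESSED).  These are STRUCTURE statements about the size of integers
(SCOREBOARD §C, growth side): no denominator / arithmetic model of these classes' linear forms exists in the tree (only
`₈π₈^∨` has one), and nothing here bears on irrationality.

METHOD (same for every class; dictionary `Families/CubicalChartFiveSpans`, engine `CubicalChartN.coeff_chart` of cert-2 g10,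
rate theorem `Families/SeatingGapGrowth.tendsto_log_gapCT_div`).  The census sum `lead_<class> n` of
`Brown8/LeadingCoefficientsA,B` is read off the cubical chart `z_{η₁}=0, z_{η_{k+1}} = x_k⋯x₅, z_{η₇}=1, z_{η₈}=∞` of its
frame `η`; in P2's simplicial convention (`Families/CellularIntegral`) the frame is the SEATING `τ = η⁻¹`, whose six finite
edges `τδ⁰` span gap intervals; `lead_<class> n = SeatingGap.gapCT τ n = [X^{n·𝟙}] ∏_{finite edges} (Σ_{span} X)^n`
(constant-term invariance: the four binomials of the census formula are the chart images of the four chords not through the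
point `z = 0`, its five `coeffPow (−n−1) ·` factors the five gap series), hence `lead ≥ 0`, and
`log lead_<class>(n)/n → −log M_τ` with `M_τ = fSup τ` identified with P2's certified growth constant of the atlas class of `τ`
(`Families/BasicGrowthClasses.fSup_ofSeating_eq_of_equivalent`, `Families/CellularEightGrowthConstants*`).

* CLASS ₈π₉ (`lead_pi9`, `Brown8/LeadingCoefficientsA`): frame `η = (1, 3, 7, 5, 2, 8, 4, 6)`, seating
  `τ = (1, 5, 2, 7, 4, 8, 3, 6)` (`tau9`, 0-based `(0, 4, 1, 6, 3, 7, 2, 5)`) ≃ atlas `(8, 3, 6, 1, 5, 2, 7, 4)` = `p8_9v` (class ₈π₉^∨);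
  finite-edge spans [0,4), [1,4), [1,6), [3,6), [2,5), [0,5); **`lead_pi9_eq_gapCT`**, `gapCT_tau9_one : gapCT = 37` at `n = 1`,
  **`tendsto_log_lead_pi9_div`**: `log lead_pi9(n)/n → −log fSup p8_9v`, growth factor
  `1/M(₈π₉^∨) ∈ (1326.9969, 1326.9970)` (`tendsto_log_lead_pi9_div_growth`).
* CLASS ₈π₉^∨ (`lead_pi9v`, `Brown8/LeadingCoefficientsA`): frame `η = (1, 5, 2, 7, 4, 8, 3, 6)`, seating
  `τ = (1, 3, 7, 5, 2, 8, 4, 6)` (`tau9v`, 0-based `(0, 2, 6, 4, 1, 7, 3, 5)`) ≃ atlas `(8, 2, 5, 7, 3, 1, 6, 4)` = `p8_9` (class ₈π₉);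
  finite-edge spans [0,2), [2,6), [4,6), [1,4), [3,5), [0,5); **`lead_pi9v_eq_gapCT`**, `gapCT_tau9v_one : gapCT = 13` at `n = 1`,
  **`tendsto_log_lead_pi9v_div`**: `log lead_pi9v(n)/n → −log fSup p8_9`, growth factor
  `1/M(₈π₉) ∈ (331.7492, 331.7493)` (`tendsto_log_lead_pi9v_div_growth`).
Exact cross-check outside the kernel: `HOME/cert-2/g11/code/s1_classes_tau.py` (`lead = gapCT τ` for `n ≤ 6`, every class;
the equivalent atlas plan; `lead(6)/lead(5)` against `1/M`).  Standard axioms only.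
-/

noncomputable section

open MvPowerSeries Finset

namespace Summit.KontsevichZagierPeriods.Zeta5Search.Families.Cellular

namespace CubicalChartN

open Summit.KontsevichZagierPeriods.Zeta5Search.Brown8 (coeffPow sumTo lead_pi9 lead_pi9_values lead_pi9v lead_pi9v_values)
open CubicalChart (coeffPow_nat_nat)

/-! # Class ₈π₉: `lead_pi9` -/

/-! ### The seating `τ = η⁻¹` -/

/-- The inverse `τ = (1, 5, 2, 7, 4, 8, 3, 6)` of the census frame `η = (1, 3, 7, 5, 2, 8, 4, 6)` of class ₈π₉, 0-based. -/
def tau9 : Fin 8 → Fin 8 := ![0, 4, 1, 6, 3, 7, 2, 5]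

/-- `τ` is the printed list `(1, 5, 2, 7, 4, 8, 3, 6)` read 0-based, and is bijective. -/
theorem tau9_spec : tau9 = ofSeating (ℓ := 5) [1, 5, 2, 7, 4, 8, 3, 6] ∧ Function.Bijective tau9 :=
  ⟨by decide, Finite.injective_iff_bijective.1 (by decide)⟩

/-- `τ` is the inverse of the frame `η = (1, 3, 7, 5, 2, 8, 4, 6)` (0-based `(0, 2, 6, 4, 1, 7, 3, 5)`). -/
theorem tau9_inverse : ∀ i, tau9 ((![0, 2, 6, 4, 1, 7, 3, 5] : Fin 8 → Fin 8) i) = i ∧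
    (![0, 2, 6, 4, 1, 7, 3, 5] : Fin 8 → Fin 8) (tau9 i) = i := by decide

/-- `τ` is a seating of class ₈π₉^∨: equivalent [Brown2016, Def. 3.1] to the atlas plan `(8, 3, 6, 1, 5, 2, 7, 4)`. -/
theorem tau9_equiv : Literature.NumberTheory.Irrationality.Brown2016.Equivalent 8 [1, 5, 2, 7, 4, 8, 3, 6]
    [8, 3, 6, 1, 5, 2, 7, 4] := by decide

/-! ### The gap polynomial of `τ`, explicitly -/

/-- **The gap polynomial of `τ`** (finite edges `{0,4}, {4,1}, {1,6}, {6,3}, {2,5}, {5,0}` of `τδ⁰` spanning [0,4), [1,4), [1,6), [3,6), [2,5), [0,5); the edges `{3,7}, {7,2}` pass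
through `∞ = 7`). -/
theorem gapPoly_tau9 (n : ℕ) : SeatingGap.gapPoly tau9 n =
    (MvPolynomial.X 0 + MvPolynomial.X 1 + MvPolynomial.X 2 + MvPolynomial.X 3) ^ n *
    (MvPolynomial.X 1 + MvPolynomial.X 2 + MvPolynomial.X 3) ^ n *
    (MvPolynomial.X 1 + MvPolynomial.X 2 + MvPolynomial.X 3 + MvPolynomial.X 4 + MvPolynomial.X 5) ^ n *
    (MvPolynomial.X 3 + MvPolynomial.X 4 + MvPolynomial.X 5) ^ n *
    (MvPolynomial.X 2 + MvPolynomial.X 3 + MvPolynomial.X 4) ^ n *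
    (MvPolynomial.X 0 + MvPolynomial.X 1 + MvPolynomial.X 2 + MvPolynomial.X 3 + MvPolynomial.X 4) ^ n := by
  have t0 : SpanHall.spanPoly (SeatingGap.edgeSpan tau9) 0 ^ SeatingGap.finExp tau9 n 0 =
      (MvPolynomial.X 0 + MvPolynomial.X 1 + MvPolynomial.X 2 + MvPolynomial.X 3) ^ n := by
    rw [SpanHall.spanPoly, show SeatingGap.edgeSpan tau9 0 = (univ.filter fun w : Fin 6 => 0 ≤ w.val ∧ w.val < 4) by decide,
      sumX_span03, show SeatingGap.finExp tau9 n 0 = n by simp [SeatingGap.finExp, tau9]]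
  have t1 : SpanHall.spanPoly (SeatingGap.edgeSpan tau9) 1 ^ SeatingGap.finExp tau9 n 1 =
      (MvPolynomial.X 1 + MvPolynomial.X 2 + MvPolynomial.X 3) ^ n := by
    rw [SpanHall.spanPoly, show SeatingGap.edgeSpan tau9 1 = (univ.filter fun w : Fin 6 => 1 ≤ w.val ∧ w.val < 4) by decide,
      sumX_span13, show SeatingGap.finExp tau9 n 1 = n by simp [SeatingGap.finExp, tau9]]
  have t2 : SpanHall.spanPoly (SeatingGap.edgeSpan tau9) 2 ^ SeatingGap.finExp tau9 n 2 =
      (MvPolynomial.X 1 + MvPolynomial.X 2 + MvPolynomial.X 3 + MvPolynomial.X 4 + MvPolynomial.X 5) ^ n := by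
    rw [SpanHall.spanPoly, show SeatingGap.edgeSpan tau9 2 = (univ.filter fun w : Fin 6 => 1 ≤ w.val ∧ w.val < 6) by decide,
      sumX_span15, show SeatingGap.finExp tau9 n 2 = n by simp [SeatingGap.finExp, tau9]]
  have t3 : SpanHall.spanPoly (SeatingGap.edgeSpan tau9) 3 ^ SeatingGap.finExp tau9 n 3 =
      (MvPolynomial.X 3 + MvPolynomial.X 4 + MvPolynomial.X 5) ^ n := by
    rw [SpanHall.spanPoly, show SeatingGap.edgeSpan tau9 3 = (univ.filter fun w : Fin 6 => 3 ≤ w.val ∧ w.val < 6) by decide,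
      sumX_span35, show SeatingGap.finExp tau9 n 3 = n by simp [SeatingGap.finExp, tau9]]
  have t4 : SpanHall.spanPoly (SeatingGap.edgeSpan tau9) 4 ^ SeatingGap.finExp tau9 n 4 = 1 := by
    rw [show SeatingGap.finExp tau9 n 4 = 0 by simp [SeatingGap.finExp, tau9], pow_zero]
  have t5 : SpanHall.spanPoly (SeatingGap.edgeSpan tau9) 5 ^ SeatingGap.finExp tau9 n 5 = 1 := by
    rw [show SeatingGap.finExp tau9 n 5 = 0 by simp [SeatingGap.finExp, tau9], pow_zero]
  have t6 : SpanHall.spanPoly (SeatingGap.edgeSpan tau9) 6 ^ SeatingGap.finExp tau9 n 6 =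
      (MvPolynomial.X 2 + MvPolynomial.X 3 + MvPolynomial.X 4) ^ n := by
    rw [SpanHall.spanPoly, show SeatingGap.edgeSpan tau9 6 = (univ.filter fun w : Fin 6 => 2 ≤ w.val ∧ w.val < 5) by decide,
      sumX_span24, show SeatingGap.finExp tau9 n 6 = n by simp [SeatingGap.finExp, tau9]]
  have t7 : SpanHall.spanPoly (SeatingGap.edgeSpan tau9) 7 ^ SeatingGap.finExp tau9 n 7 =
      (MvPolynomial.X 0 + MvPolynomial.X 1 + MvPolynomial.X 2 + MvPolynomial.X 3 + MvPolynomial.X 4) ^ n := by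
    rw [SpanHall.spanPoly, show SeatingGap.edgeSpan tau9 7 = (univ.filter fun w : Fin 6 => 0 ≤ w.val ∧ w.val < 5) by decide,
      sumX_span04, show SeatingGap.finExp tau9 n 7 = n by simp [SeatingGap.finExp, tau9]]
  unfold SeatingGap.gapPoly SpanHall.spanProd
  show ∏ i : Fin 8, SpanHall.spanPoly (SeatingGap.edgeSpan tau9) i ^ SeatingGap.finExp tau9 n i = _
  rw [Fin.prod_univ_eight, t0, t1, t2, t3, t4, t5, t6, t7]
  ring

/-! ### The chart image of the gap polynomial -/

/-- The prefactor monomial of the chart image, as a product. -/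
theorem monomial_c9 (n : ℕ) :
    (monomial ((2 * n) • tail (3 : Fin 6) + (2 * n) • tail (4 : Fin 6)) (1 : ℤ) : T 5) = (x 3 * x 4) ^ (2 * n) * x 4 ^ (2 * n) := by
  rw [MvPowerSeries.monomial_one_eq, Finsupp.prod_fintype _ _ (fun i => by simp)]
  simp only [Fin.prod_univ_five, Finsupp.coe_add, Finsupp.coe_smul, Pi.add_apply, Pi.smul_apply, tail_apply,
    smul_eq_mul]
  simp only [Fin.isValue, Fin.val_zero, Fin.val_one, Fin.val_two, show (3 : Fin 6).val = 3 from rfl, show (4 : Fin 6).val = 4 from rfl, show (3 : Fin 5).val = 3 from rfl, show (4 : Fin 5).val = 4 from rfl]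
  norm_num
  ring

/-- **The chart image of the gap polynomial of `τ`**, binomial factors in the census file's summation order
`k₁ ↦ 1−x^(seg 0 2)`, `k₂ ↦ 1−x^(seg 0 4)`, `k₃ ↦ 1−x^(seg 1 3)`, `k₄ ↦ 1−x^(seg 2 4)` (0-based variables). -/
theorem chart_gapPoly_tau9 (n : ℕ) :
    chart (SeatingGap.gapPoly tau9 n) = (monomial ((2 * n) • tail (3 : Fin 6) + (2 * n) • tail (4 : Fin 6)) 1 : T 5) *
      ((1 - monomial (seg 0 2) 1) ^ n * ((1 - monomial (seg 0 4) 1) ^ n * ((1 - monomial (seg 1 3) 1) ^ n *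
        (1 - monomial (seg 2 4) 1) ^ n))) := by
  rw [gapPoly_tau9, map_mul, map_mul, map_mul, map_mul, map_mul, map_pow, map_pow, map_pow, map_pow, map_pow, map_pow,
    chart_span03, chart_span13, chart_span15, chart_span35, chart_span24, chart_span04, monomial_c9,
    monomial_seg02, monomial_seg04, monomial_seg13, monomial_seg24]
  simp only [mul_pow]
  ring

/-! ### The census sum -/

/-- **fam-brown8's census leading coefficient of class ₈π₉ IS the diagonal gap constant term of the seating `τ`**:
`lead_pi9 n = gapCT tau9 n` for every `n`. -/
theorem lead_pi9_eq_gapCT (n : ℕ) : lead_pi9 n = SeatingGap.gapCT tau9 n := by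
  -- homogeneity: `6n`
  have hdeg : (SeatingGap.gapPoly tau9 n).IsHomogeneous (∑ w : Fin 6, (fun _ : Fin 6 => n) w) := by
    have h := SeatingGap.gapPoly_isHomogeneous tau9 n
    have e : ∑ i, SeatingGap.finExp tau9 n i = ∑ w : Fin 6, (fun _ : Fin 6 => n) w := by
      simp [SeatingGap.finExp, tau9, Fin.sum_univ_eight]; ring
    rwa [e] at h
  have hct := coeff_chart (SeatingGap.gapPoly tau9 n) (fun _ : Fin 6 => n) hdeg
  symm
  unfold SeatingGap.gapCT
  rw [SeatingGap.smul_ones, ← hct, ← coeffZ_natCast, chart_gapPoly_tau9, mul_assoc, coeffZ_monomial_mul]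
  simp only [mul_assoc, coeffZ_oneSubPow_mul, coeffZ_U, Finset.mul_sum]
  -- the census side
  unfold lead_pi9
  simp only [CubicalChart.sumTo_eq_sum]
  refine Finset.sum_congr rfl fun k₁ _ => Finset.sum_congr rfl fun k₂ _ => Finset.sum_congr rfl fun k₃ _ =>
    Finset.sum_congr rfl fun k₄ _ => ?_
  simp only [coeffPow_nat_nat]
  rw [Fin.prod_univ_five]
  simp only [Mexp_apply6, Fin.sum_univ_six, Finsupp.coe_equivFunOnFinite_symm, Finsupp.coe_add, Finsupp.coe_smul,
    Pi.add_apply, Pi.smul_apply, smul_eq_mul, tail_apply, seg_apply, Fin.isValue]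
  simp only [Fin.val_zero, Fin.val_one, Fin.val_two, show (3 : Fin 6).val = 3 from rfl,
    show (4 : Fin 6).val = 4 from rfl, show (5 : Fin 6).val = 5 from rfl, show (3 : Fin 5).val = 3 from rfl,
    show (4 : Fin 5).val = 4 from rfl]
  norm_num
  ring_nf

/-- `lead_pi9 n ≥ 0` (a count of transport tables). -/
theorem lead_pi9_nonneg (n : ℕ) : 0 ≤ lead_pi9 n := by
  rw [lead_pi9_eq_gapCT]; exact SeatingGap.gapCT_nonneg tau9 n

/-- `gapCT τ 1 = 37` (the census value `lead_pi9 1 = 37`). -/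
theorem gapCT_tau9_one : SeatingGap.gapCT tau9 1 = 37 := by
  rw [← lead_pi9_eq_gapCT]
  have h := lead_pi9_values
  simp only [List.cons.injEq] at h
  exact h.2.1

/-! ### The growth exponent of `lead_pi9` -/

/-- **`M_τ = M(₈π₉^∨)`**: the growth constant of the seating `τ` is that of the atlas representative `p8_9v`
(class function, `Families/BasicGrowthClasses.fSup_ofSeating_eq_of_equivalent`). -/
theorem fSup_tau9 : fSup tau9 = fSup p8_9v := by
  rw [tau9_spec.1, p8_9v_spec.1]
  exact fSup_ofSeating_eq_of_equivalent (by decide) (by decide) tau9_equiv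

/-- **Growth exponent of the census leading coefficients of class ₈π₉**: `log lead_pi9(n) / n → −log M(₈π₉^∨)`,
`M(₈π₉^∨) = fSup p8_9v` the growth constant of the basic cellular integrals of the seating `τ` (P2,
`Families/CellularEightGrowthConstantsC`): growth of the leading coefficients = reciprocal of the decay of those integrals
(`Families/SeatingGapGrowth`). -/
theorem tendsto_log_lead_pi9_div :
    Filter.Tendsto (fun n : ℕ => Real.log (lead_pi9 n : ℝ) / n) Filter.atTop (nhds (-Real.log (fSup p8_9v))) := by
  have h := SeatingGap.tendsto_log_gapCT_div tau9 tau9_spec.2 (by rw [gapCT_tau9_one]; norm_num)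
  rw [fSup_tau9] at h
  exact h.congr fun n => by rw [lead_pi9_eq_gapCT]

/-- **The growth factor, certified**: `log lead_pi9(n)/n → log λ` with `λ = 1/M(₈π₉^∨) ∈ (1326.9969, 1326.9970)`
(P2's enclosure `fSup_p8_9v_mem_Icc`). -/
theorem tendsto_log_lead_pi9_div_growth : ∃ lam : ℝ, lam = (fSup p8_9v)⁻¹ ∧
    (13269969 : ℝ) / 10000 < lam ∧ lam < (13269970 : ℝ) / 10000 ∧
    Filter.Tendsto (fun n : ℕ => Real.log (lead_pi9 n : ℝ) / n) Filter.atTop (nhds (Real.log lam)) := by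
  have hpos : 0 < fSup p8_9v := fSup_pos p8_9v (Finite.injective_iff_bijective.1 p8_9v_spec.2.1)
  obtain ⟨hlo, hhi⟩ := fSup_p8_9v_mem_Icc
  refine ⟨(fSup p8_9v)⁻¹, rfl, ?_, ?_, ?_⟩
  · rw [lt_inv_comm₀ (by norm_num) hpos]
    exact lt_of_le_of_lt hhi (by norm_num)
  · rw [inv_lt_comm₀ hpos (by norm_num)]
    exact lt_of_lt_of_le (by norm_num) hlo
  · rw [Real.log_inv]
    exact tendsto_log_lead_pi9_div


/-! # Class ₈π₉^∨: `lead_pi9v` -/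

/-! ### The seating `τ = η⁻¹` -/

/-- The inverse `τ = (1, 3, 7, 5, 2, 8, 4, 6)` of the census frame `η = (1, 5, 2, 7, 4, 8, 3, 6)` of class ₈π₉^∨, 0-based. -/
def tau9v : Fin 8 → Fin 8 := ![0, 2, 6, 4, 1, 7, 3, 5]

/-- `τ` is the printed list `(1, 3, 7, 5, 2, 8, 4, 6)` read 0-based, and is bijective. -/
theorem tau9v_spec : tau9v = ofSeating (ℓ := 5) [1, 3, 7, 5, 2, 8, 4, 6] ∧ Function.Bijective tau9v :=
  ⟨by decide, Finite.injective_iff_bijective.1 (by decide)⟩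

/-- `τ` is the inverse of the frame `η = (1, 5, 2, 7, 4, 8, 3, 6)` (0-based `(0, 4, 1, 6, 3, 7, 2, 5)`). -/
theorem tau9v_inverse : ∀ i, tau9v ((![0, 4, 1, 6, 3, 7, 2, 5] : Fin 8 → Fin 8) i) = i ∧
    (![0, 4, 1, 6, 3, 7, 2, 5] : Fin 8 → Fin 8) (tau9v i) = i := by decide

/-- `τ` is a seating of class ₈π₉: equivalent [Brown2016, Def. 3.1] to the atlas plan `(8, 2, 5, 7, 3, 1, 6, 4)`. -/
theorem tau9v_equiv : Literature.NumberTheory.Irrationality.Brown2016.Equivalent 8 [1, 3, 7, 5, 2, 8, 4, 6]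
    [8, 2, 5, 7, 3, 1, 6, 4] := by decide

/-! ### The gap polynomial of `τ`, explicitly -/

/-- **The gap polynomial of `τ`** (finite edges `{0,2}, {2,6}, {6,4}, {4,1}, {3,5}, {5,0}` of `τδ⁰` spanning [0,2), [2,6), [4,6), [1,4), [3,5), [0,5); the edges `{1,7}, {7,3}` pass
through `∞ = 7`). -/
theorem gapPoly_tau9v (n : ℕ) : SeatingGap.gapPoly tau9v n =
    (MvPolynomial.X 0 + MvPolynomial.X 1) ^ n *
    (MvPolynomial.X 2 + MvPolynomial.X 3 + MvPolynomial.X 4 + MvPolynomial.X 5) ^ n *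
    (MvPolynomial.X 4 + MvPolynomial.X 5) ^ n *
    (MvPolynomial.X 1 + MvPolynomial.X 2 + MvPolynomial.X 3) ^ n *
    (MvPolynomial.X 3 + MvPolynomial.X 4) ^ n *
    (MvPolynomial.X 0 + MvPolynomial.X 1 + MvPolynomial.X 2 + MvPolynomial.X 3 + MvPolynomial.X 4) ^ n := by
  have t0 : SpanHall.spanPoly (SeatingGap.edgeSpan tau9v) 0 ^ SeatingGap.finExp tau9v n 0 =
      (MvPolynomial.X 0 + MvPolynomial.X 1) ^ n := by
    rw [SpanHall.spanPoly, show SeatingGap.edgeSpan tau9v 0 = (univ.filter fun w : Fin 6 => 0 ≤ w.val ∧ w.val < 2) by decide,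
      sumX_span01, show SeatingGap.finExp tau9v n 0 = n by simp [SeatingGap.finExp, tau9v]]
  have t1 : SpanHall.spanPoly (SeatingGap.edgeSpan tau9v) 1 ^ SeatingGap.finExp tau9v n 1 =
      (MvPolynomial.X 2 + MvPolynomial.X 3 + MvPolynomial.X 4 + MvPolynomial.X 5) ^ n := by
    rw [SpanHall.spanPoly, show SeatingGap.edgeSpan tau9v 1 = (univ.filter fun w : Fin 6 => 2 ≤ w.val ∧ w.val < 6) by decide,
      sumX_span25, show SeatingGap.finExp tau9v n 1 = n by simp [SeatingGap.finExp, tau9v]]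
  have t2 : SpanHall.spanPoly (SeatingGap.edgeSpan tau9v) 2 ^ SeatingGap.finExp tau9v n 2 =
      (MvPolynomial.X 4 + MvPolynomial.X 5) ^ n := by
    rw [SpanHall.spanPoly, show SeatingGap.edgeSpan tau9v 2 = (univ.filter fun w : Fin 6 => 4 ≤ w.val ∧ w.val < 6) by decide,
      sumX_span45, show SeatingGap.finExp tau9v n 2 = n by simp [SeatingGap.finExp, tau9v]]
  have t3 : SpanHall.spanPoly (SeatingGap.edgeSpan tau9v) 3 ^ SeatingGap.finExp tau9v n 3 =
      (MvPolynomial.X 1 + MvPolynomial.X 2 + MvPolynomial.X 3) ^ n := by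
    rw [SpanHall.spanPoly, show SeatingGap.edgeSpan tau9v 3 = (univ.filter fun w : Fin 6 => 1 ≤ w.val ∧ w.val < 4) by decide,
      sumX_span13, show SeatingGap.finExp tau9v n 3 = n by simp [SeatingGap.finExp, tau9v]]
  have t4 : SpanHall.spanPoly (SeatingGap.edgeSpan tau9v) 4 ^ SeatingGap.finExp tau9v n 4 = 1 := by
    rw [show SeatingGap.finExp tau9v n 4 = 0 by simp [SeatingGap.finExp, tau9v], pow_zero]
  have t5 : SpanHall.spanPoly (SeatingGap.edgeSpan tau9v) 5 ^ SeatingGap.finExp tau9v n 5 = 1 := by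
    rw [show SeatingGap.finExp tau9v n 5 = 0 by simp [SeatingGap.finExp, tau9v], pow_zero]
  have t6 : SpanHall.spanPoly (SeatingGap.edgeSpan tau9v) 6 ^ SeatingGap.finExp tau9v n 6 =
      (MvPolynomial.X 3 + MvPolynomial.X 4) ^ n := by
    rw [SpanHall.spanPoly, show SeatingGap.edgeSpan tau9v 6 = (univ.filter fun w : Fin 6 => 3 ≤ w.val ∧ w.val < 5) by decide,
      sumX_span34, show SeatingGap.finExp tau9v n 6 = n by simp [SeatingGap.finExp, tau9v]]
  have t7 : SpanHall.spanPoly (SeatingGap.edgeSpan tau9v) 7 ^ SeatingGap.finExp tau9v n 7 =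
      (MvPolynomial.X 0 + MvPolynomial.X 1 + MvPolynomial.X 2 + MvPolynomial.X 3 + MvPolynomial.X 4) ^ n := by
    rw [SpanHall.spanPoly, show SeatingGap.edgeSpan tau9v 7 = (univ.filter fun w : Fin 6 => 0 ≤ w.val ∧ w.val < 5) by decide,
      sumX_span04, show SeatingGap.finExp tau9v n 7 = n by simp [SeatingGap.finExp, tau9v]]
  unfold SeatingGap.gapPoly SpanHall.spanProd
  show ∏ i : Fin 8, SpanHall.spanPoly (SeatingGap.edgeSpan tau9v) i ^ SeatingGap.finExp tau9v n i = _
  rw [Fin.prod_univ_eight, t0, t1, t2, t3, t4, t5, t6, t7]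
  ring

/-! ### The chart image of the gap polynomial -/

/-- The prefactor monomial of the chart image, as a product. -/
theorem monomial_c9v (n : ℕ) :
    (monomial (n • tail (1 : Fin 6) + n • tail (3 : Fin 6) + (2 * n) • tail (4 : Fin 6)) (1 : ℤ) : T 5) = (x 1 * x 2 * x 3 * x 4) ^ n * (x 3 * x 4) ^ n * x 4 ^ (2 * n) := by
  rw [MvPowerSeries.monomial_one_eq, Finsupp.prod_fintype _ _ (fun i => by simp)]
  simp only [Fin.prod_univ_five, Finsupp.coe_add, Finsupp.coe_smul, Pi.add_apply, Pi.smul_apply, tail_apply,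
    smul_eq_mul]
  simp only [Fin.isValue, Fin.val_zero, Fin.val_one, Fin.val_two, show (3 : Fin 6).val = 3 from rfl, show (4 : Fin 6).val = 4 from rfl, show (3 : Fin 5).val = 3 from rfl, show (4 : Fin 5).val = 4 from rfl]
  norm_num
  ring

/-- **The chart image of the gap polynomial of `τ`**, binomial factors in the census file's summation order
`k₁ ↦ 1−x^(seg 0 2)`, `k₂ ↦ 1−x^(seg 1 4)`, `k₃ ↦ 1−x^(seg 2 3)`, `k₄ ↦ 1−x^(seg 3 4)` (0-based variables). -/
theorem chart_gapPoly_tau9v (n : ℕ) :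
    chart (SeatingGap.gapPoly tau9v n) = (monomial (n • tail (1 : Fin 6) + n • tail (3 : Fin 6) + (2 * n) • tail (4 : Fin 6)) 1 : T 5) *
      ((1 - monomial (seg 0 2) 1) ^ n * ((1 - monomial (seg 1 4) 1) ^ n * ((1 - monomial (seg 2 3) 1) ^ n *
        (1 - monomial (seg 3 4) 1) ^ n))) := by
  rw [gapPoly_tau9v, map_mul, map_mul, map_mul, map_mul, map_mul, map_pow, map_pow, map_pow, map_pow, map_pow, map_pow,
    chart_span01, chart_span25, chart_span45, chart_span13, chart_span34, chart_span04, monomial_c9v,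
    monomial_seg02, monomial_seg14, monomial_seg23, monomial_seg34]
  simp only [mul_pow]
  ring

/-! ### The census sum -/

/-- **fam-brown8's census leading coefficient of class ₈π₉^∨ IS the diagonal gap constant term of the seating `τ`**:
`lead_pi9v n = gapCT tau9v n` for every `n`. -/
theorem lead_pi9v_eq_gapCT (n : ℕ) : lead_pi9v n = SeatingGap.gapCT tau9v n := by
  -- homogeneity: `6n`
  have hdeg : (SeatingGap.gapPoly tau9v n).IsHomogeneous (∑ w : Fin 6, (fun _ : Fin 6 => n) w) := by
    have h := SeatingGap.gapPoly_isHomogeneous tau9v n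
    have e : ∑ i, SeatingGap.finExp tau9v n i = ∑ w : Fin 6, (fun _ : Fin 6 => n) w := by
      simp [SeatingGap.finExp, tau9v, Fin.sum_univ_eight]; ring
    rwa [e] at h
  have hct := coeff_chart (SeatingGap.gapPoly tau9v n) (fun _ : Fin 6 => n) hdeg
  symm
  unfold SeatingGap.gapCT
  rw [SeatingGap.smul_ones, ← hct, ← coeffZ_natCast, chart_gapPoly_tau9v, mul_assoc, coeffZ_monomial_mul]
  simp only [mul_assoc, coeffZ_oneSubPow_mul, coeffZ_U, Finset.mul_sum]
  -- the census side
  unfold lead_pi9v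
  simp only [CubicalChart.sumTo_eq_sum]
  refine Finset.sum_congr rfl fun k₁ _ => Finset.sum_congr rfl fun k₂ _ => Finset.sum_congr rfl fun k₃ _ =>
    Finset.sum_congr rfl fun k₄ _ => ?_
  simp only [coeffPow_nat_nat]
  rw [Fin.prod_univ_five]
  simp only [Mexp_apply6, Fin.sum_univ_six, Finsupp.coe_equivFunOnFinite_symm, Finsupp.coe_add, Finsupp.coe_smul,
    Pi.add_apply, Pi.smul_apply, smul_eq_mul, tail_apply, seg_apply, Fin.isValue]
  simp only [Fin.val_zero, Fin.val_one, Fin.val_two, show (3 : Fin 6).val = 3 from rfl,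
    show (4 : Fin 6).val = 4 from rfl, show (5 : Fin 6).val = 5 from rfl, show (3 : Fin 5).val = 3 from rfl,
    show (4 : Fin 5).val = 4 from rfl]
  norm_num
  ring_nf

/-- `lead_pi9v n ≥ 0` (a count of transport tables). -/
theorem lead_pi9v_nonneg (n : ℕ) : 0 ≤ lead_pi9v n := by
  rw [lead_pi9v_eq_gapCT]; exact SeatingGap.gapCT_nonneg tau9v n

/-- `gapCT τ 1 = 13` (the census value `lead_pi9v 1 = 13`). -/
theorem gapCT_tau9v_one : SeatingGap.gapCT tau9v 1 = 13 := by
  rw [← lead_pi9v_eq_gapCT]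
  have h := lead_pi9v_values
  simp only [List.cons.injEq] at h
  exact h.2.1

/-! ### The growth exponent of `lead_pi9v` -/

/-- **`M_τ = M(₈π₉)`**: the growth constant of the seating `τ` is that of the atlas representative `p8_9`
(class function, `Families/BasicGrowthClasses.fSup_ofSeating_eq_of_equivalent`). -/
theorem fSup_tau9v : fSup tau9v = fSup p8_9 := by
  rw [tau9v_spec.1, p8_9_spec.1]
  exact fSup_ofSeating_eq_of_equivalent (by decide) (by decide) tau9v_equiv

/-- **Growth exponent of the census leading coefficients of class ₈π₉^∨**: `log lead_pi9v(n) / n → −log M(₈π₉)`,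
`M(₈π₉) = fSup p8_9` the growth constant of the basic cellular integrals of the seating `τ` (P2,
`Families/CellularEightGrowthConstantsC`): growth of the leading coefficients = reciprocal of the decay of those integrals
(`Families/SeatingGapGrowth`). -/
theorem tendsto_log_lead_pi9v_div :
    Filter.Tendsto (fun n : ℕ => Real.log (lead_pi9v n : ℝ) / n) Filter.atTop (nhds (-Real.log (fSup p8_9))) := by
  have h := SeatingGap.tendsto_log_gapCT_div tau9v tau9v_spec.2 (by rw [gapCT_tau9v_one]; norm_num)
  rw [fSup_tau9v] at h
  exact h.congr fun n => by rw [lead_pi9v_eq_gapCT]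

/-- **The growth factor, certified**: `log lead_pi9v(n)/n → log λ` with `λ = 1/M(₈π₉) ∈ (331.7492, 331.7493)`
(P2's enclosure `fSup_p8_9_mem_Icc`). -/
theorem tendsto_log_lead_pi9v_div_growth : ∃ lam : ℝ, lam = (fSup p8_9)⁻¹ ∧
    (3317492 : ℝ) / 10000 < lam ∧ lam < (3317493 : ℝ) / 10000 ∧
    Filter.Tendsto (fun n : ℕ => Real.log (lead_pi9v n : ℝ) / n) Filter.atTop (nhds (Real.log lam)) := by
  have hpos : 0 < fSup p8_9 := fSup_pos p8_9 (Finite.injective_iff_bijective.1 p8_9_spec.2.1)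
  obtain ⟨hlo, hhi⟩ := fSup_p8_9_mem_Icc
  refine ⟨(fSup p8_9)⁻¹, rfl, ?_, ?_, ?_⟩
  · rw [lt_inv_comm₀ (by norm_num) hpos]
    exact lt_of_le_of_lt hhi (by norm_num)
  · rw [inv_lt_comm₀ hpos (by norm_num)]
    exact lt_of_lt_of_le (by norm_num) hlo
  · rw [Real.log_inv]
    exact tendsto_log_lead_pi9v_div


end CubicalChartN

end Summit.KontsevichZagierPeriods.Zeta5Search.Families.Cellular
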